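import Literature.NumberTheory.Rogawski1990.FinExplicitKappaObstruction
import Literature.NumberTheory.Rogawski1990.ArchExplicitKappaObstruction
import Literature.NumberTheory.Rogawski1990.ExplicitFactorProductFormula
import Literature.NumberTheory.Rogawski1990.CartanObstructionSubgroup
import HarnessLib

/-!
# The global transfer-factor identity (4.3.3) `Δ‴_𝐀(γ_H, γ̄_f) · Δ‴_∞(γ_H ⊗ 1, γ̄_∞) = (e 𝒪H)(obs γ̄)` FOR ROGAWSKI'S EXPLICIT COLLECTION AND KOTTWITZ'S
# OBSTRUCTION — the κ-clause of ★ `GlobalTransferWithCartanKappaFormula` at `Δ‴`, proved (Rogawski 1990, §4.3 (4.3.2)–(4.3.3) pp. 43–44, §14.6 p. 242;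
# Langlands–Shelstad 1987 §6.4; Kottwitz 1986 §9)

Topic `NumberTheory/Rogawski1990`; namespace `Literature.NumberTheory.Rogawski1990`; **THEOREMS ONLY** (no definition, no named fact, no instance, no
notation, no `sorry`).  Cell `pub/hodgecm-mathlib`, ENGINE T1 (crux H413 = `stmt-HodgeConjecture-24833`), T6 #72-side node **N5 = the T6-L3 stub `stub_kappaFormula`**
(F0P3a-p08 (g8)'s `Lines-draft/T6c_GlobalTransferCartanKappaPaydown.lean` :217; desk TABLE #4, F0P3a-p04 (g8)): part (B), the assembly.  With the explicit finite
collection `Δ‴ = finExplicitCollection L H′ μ hl hr` (★ typ-T6b p827456) and the canonical archimedean factor `Δ‴_∞ = archCanonicalDelta` (★ p827252), for `H′`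
anisotropic hermitian with `det H′` a unit, `γ₀ ∈ U(H′)(L⁺)` regular, the dictionary `s` of ★ `GlobalTransferWithCartanKappaFormula` with its pins
`e(𝒪H)(ε) = (−1)^{ε(s 𝒪H)}` and every `γ_H → γ₀`, EVERY matching adèle `γ̄` over `γ_H` satisfies
`(∏ᶠ_v Δ‴_v((γ_H)_v, γ̄_v)) · Δ‴_∞(γ_H ⊗ 1, γ̄_∞) = (e 𝒪H)(cartanObs γ̄)` — so the printed citation [LanglandsShelstad1987, Cor. 6.4.B ∕ Rogawski (4.3.3)] for
`U(3)` and Kottwitz's `κ` is a THEOREM for the explicit factor.  HC_CM is proved only modulo the printed citations until rung 0 closes; this file discharges one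
stub of a pay-down line, it does not touch the head's books by itself.

THE MATHEMATICS.  On a matching pair every local factor is `τ_v · D_v · κ_v` resp. `τ_∞ · D_∞ · ∏_w κ‴_w` (★ `finExplicitDelta_of_isLocalNormPair`,
★ `archCanonicalDelta_of_isArchNormPair`); `τ` and `D_{G∕H}` read only the RATIONAL `γ_H`, so their products over all places are `1` exactly as in the product
formula (★ F0P3a-p05 `finprod_finTau_mul_archTau_eq_one`, `finprod_finWeylRatio_mul_archWeylRatio_eq_one`: Hecke character on principal idèles, Artin–Whaples);
the `κ`'s of the ADELIC `γ̄ = g(γ₀ ⊗ 1)g⁻¹` are the local norm-residue symbols `(W_v, θ)_v`, `(W_{w₀}, θ)_{w₀}` of the idèle `W ∈ 𝕀_{L⁺}` below the `H′`-value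
`⟨g(v₀⊗1), g(v₀⊗1)⟩` of the transported `u`-eigenvector (★ (A1) `MatchingAdele.finKappaAt_toLocal_eq_hilbertSymbol`, ★ (A2) F0P3a-p07
`MatchingAdele.archKappaSignAt_arch_eq_hilbertSymbol`), whose total product is `(−1)^{[W]_{L⁺,θ}}` (★ `quadraticArtinIndicator_eq_zero_iff_prod_hilbertSymbol_eq_one`,
O'Meara 71:18–19), and `[W]_{L⁺,θ} = (obs γ̄)_{s 𝒪H}` is Kottwitz's obstruction at the degree-one factor (★ `MatchingAdeleG₂.cartanObsFun_eq_quadraticArtinIndicator_hermForm`,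
[Rogawski1990, Prop. 3.5.2 (c)]); the pin turns `(−1)^{(obs γ̄)_{s 𝒪H}}` into `(e 𝒪H)(obs γ̄)` [§5.4 (5.4.5)].

* §1 **`MatchingAdele.finprod_finKappaAt_mul_prod_archKappaSignAt_eq_neg_one_pow`** — `(∏ᶠ_v κ_v)·∏_w κ‴_w = (−1)^{[W]}` (given the archimedean readings).
* §2 `MatchingAdele.adelicFactor_finExplicitCollection_eq` (unfolding on a matching adèle), **`MatchingAdele.adelicFactor_finExplicitCollection_eq_neg_one_pow`**
  (`Δ‴_𝐀·Δ‴_∞ = (−1)^{[W]}`), **`globalKappaFormula_finExplicitCollection L H′ μ hl hr`** = the κ-clause of ★ `GlobalTransferWithCartanKappaFormula` at `(Δ‴, Δ‴_∞)`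
  TOKEN FOR TOKEN (`stub_kappaFormula := globalKappaFormula_finExplicitCollection L H' μ (finExplicitDelta_conj_left_all L H' μ) (finExplicitDelta_conj_right_all L H' μ)`).

## References
* [Rogawski1990] J. D. Rogawski, *Automorphic Representations of Unitary Groups in Three Variables*, Ann. of Math. Stud. 123 (1990), §3.3 (3.3.1) p. 22; §3.5
  Prop. 3.5.2 (c) p. 29; §4.3 (4.3.2)–(4.3.3) pp. 43–44; §4.9 p. 55; §5.4 (5.4.5) p. 73; §14.6 p. 242.
* [LanglandsShelstad1987] R. P. Langlands, D. Shelstad, *On the definition of transfer factors*, Math. Ann. 278 (1987), §6.4 Thm. 6.4.A, Cor. 6.4.B.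
* [Kottwitz1986] R. E. Kottwitz, *Stable trace formula: elliptic singular terms*, Math. Ann. 275 (1986), §9.
* [Omeara1963] O. T. O'Meara, *Introduction to Quadratic Forms* (1963), §71 Thms. 71:18–71:19.
-/

set_option autoImplicit false

noncomputable section

open NumberField NumberField.InfinitePlace NumberField.mixedEmbedding IsDedekindDomain Filter Matrix
open Literature.NumberTheory.GaloisRepresentations Literature.NumberTheory.QuadraticForms
open Literature.AlgebraicGeometry.ShimuraVarieties (unitaryGroup hermForm)
open scoped Classical ComplexOrder MatrixGroups

namespace Literature.NumberTheory.Rogawski1990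

open Literature.NumberTheory.Automorphic

section KappaProduct

variable {L : Type} [Field L] [NumberField L] [IsCMField L] {H' : Matrix (Fin 3) (Fin 3) L}
  {γH : (UnitaryGroup.cmDatum L 2 (Matrix.of fun i j : Fin 2 => if i.val + j.val + 1 = 2 then (1 : L) else 0)).Rational ×
    (UnitaryGroup.cmDatum L 1 (Matrix.of fun i j : Fin 1 => if i.val + j.val + 1 = 1 then (1 : L) else 0)).Rational}
  {γ₀ : (UnitaryGroup.cmDatum L 3 H').Rational}

/-- `θ ≠ 0` (`θ ∉ (L⁺)²`). [folklore] -/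
private theorem cmQuadraticGenerator_ne_zero' : (cmQuadraticGenerator L : ↥(maximalRealSubfield L)) ≠ 0 := fun h =>
  not_isSquare_cmQuadraticGenerator L (by rw [h]; exact IsSquare.zero)

/-- A finite product of signs `±1` is a sign. [folklore] -/
private theorem prod_eq_one_or_eq_neg_one {ι : Type*} (s : Finset ι) (f : ι → ℤ) (hf : ∀ i ∈ s, f i = 1 ∨ f i = -1) :
    ∏ i ∈ s, f i = 1 ∨ ∏ i ∈ s, f i = -1 := by
  induction s using Finset.induction_on with
  | empty => exact Or.inl Finset.prod_empty
  | insert a s ha ih =>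
      rw [Finset.prod_insert ha]
      rcases hf a (Finset.mem_insert_self a s) with h1 | h1 <;>
        rcases ih (fun i hi => hf i (Finset.mem_insert_of_mem hi)) with h2 | h2 <;> rw [h1, h2] <;> norm_num

/-- **THE `κ`-PRODUCT OF AN ADELIC MATCHING PAIR IS THE QUADRATIC ARTIN SIGN `(−1)^{[W]}`**: with the finite `κ_v`'s and the archimedean `κ‴_w`'s all read
as local norm-residue symbols of the one idèle `W ∈ 𝕀_{L⁺}` (★ `MatchingAdele.finKappaAt_toLocal_eq_hilbertSymbol`; the archimedean readings `harch`), the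
total product over the places of `L⁺` is `(−1)^{[W]_{L⁺,θ}}` (★ `quadraticArtinIndicator_eq_zero_iff_prod_hilbertSymbol_eq_one`, complex places of `L` ↔ places
of `L⁺` by Mathlib `IsCMField.equivInfinitePlace`). [cite: Rogawski1990, §4.3 (4.3.3) p. 44; §14.6 p. 242] [cite: Omeara1963, §71 Thms. 71:18–71:19] -/
theorem MatchingAdele.finprod_finKappaAt_mul_prod_archKappaSignAt_eq_neg_one_pow (p : MatchingAdele L H' γH)
    (hGreg : IsGRegular (cmConjRingHom L) (Matrix.of fun i j : Fin 2 => if i.val + j.val + 1 = 2 then (1 : L) else 0)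
        (Matrix.of fun i j : Fin 1 => if i.val + j.val + 1 = 1 then (1 : L) else 0)
        (Matrix.of fun i j : Fin 3 => if i.val + j.val + 1 = 3 then (1 : L) else 0) endoForm_antidiagOne γH)
    {g : GL (Fin 3) (AdeleRing (𝓞 L) L)}
    (hg : g * (((UnitaryGroup.cmDatum L 3 H').toAdelic γ₀).val : GL (Fin 3) (AdeleRing (𝓞 L) L)) * g⁻¹ = (p.adele.val : GL (Fin 3) (AdeleRing (𝓞 L) L)))
    {v₀ : Fin 3 → L}
    (hv₀ : (((γ₀ : unitaryGroup (cmConjRingHom L) H').val : GL (Fin 3) L) : Matrix (Fin 3) (Fin 3) L) *ᵥ v₀ = ((γH.2.val.val : Matrix (Fin 1) (Fin 1) L) 0 0) • v₀)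
    (hv₀0 : v₀ ≠ 0) (W : (AdeleRing (𝓞 ↥(maximalRealSubfield L)) ↥(maximalRealSubfield L))ˣ)
    (hW : ((AdeleRing.ideleBaseChange (↥(maximalRealSubfield L)) L W : (AdeleRing (𝓞 L) L)ˣ) : AdeleRing (𝓞 L) L) =
      hermForm (adeleConj L) (H'.map (algebraMap L (AdeleRing (𝓞 L) L)))
        ((g : Matrix (Fin 3) (Fin 3) (AdeleRing (𝓞 L) L)) *ᵥ ((algebraMap L (AdeleRing (𝓞 L) L)) ∘ v₀))
        ((g : Matrix (Fin 3) (Fin 3) (AdeleRing (𝓞 L) L)) *ᵥ ((algebraMap L (AdeleRing (𝓞 L) L)) ∘ v₀)))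
    (harch : ∀ w : {w : InfinitePlace L // IsComplex w},
      archKappaSignAt L H' (rationalArch L γH) w p.arch =
        hilbertSymbol (IsCMField.equivInfinitePlace L w.1).Completion
          ((((W : (AdeleRing (𝓞 ↥(maximalRealSubfield L)) ↥(maximalRealSubfield L))ˣ) : AdeleRing (𝓞 ↥(maximalRealSubfield L)) ↥(maximalRealSubfield L)).1
            (IsCMField.equivInfinitePlace L w.1) : (IsCMField.equivInfinitePlace L w.1).Completion))
          (algebraMap ↥(maximalRealSubfield L) _ (cmQuadraticGenerator L : ↥(maximalRealSubfield L)))) :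
    (∏ᶠ v : HeightOneSpectrum (𝓞 ↥(maximalRealSubfield L)),
        finKappaAt L v H' (rationalComponent L γH v) ((UnitaryGroup.cmDatum L 3 H').toLocal v p.adele)) *
      ∏ w : {w : InfinitePlace L // IsComplex w}, archKappaSignAt L H' (rationalArch L γH) w p.arch =
      (-1) ^ (quadraticArtinIndicator (↥(maximalRealSubfield L)) (cmQuadraticGenerator L : ↥(maximalRealSubfield L)) W).val := by
  -- the bad set `S` of finite places where `W_v` is not a local norm
  have hθ0 := cmQuadraticGenerator_ne_zero' (L := L)
  have hfinS := finite_setOf_ideleFiniteComponent_not_mem_quadraticNormSubgroup hθ0 W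
  set S : Finset (HeightOneSpectrum (𝓞 ↥(maximalRealSubfield L))) := hfinS.toFinset with hSdef
  have hS : ∀ v ∉ S, ideleFiniteComponent (↥(maximalRealSubfield L)) v W ∈
      quadraticNormSubgroup (v.adicCompletion ↥(maximalRealSubfield L)) (algebraMap _ _ (cmQuadraticGenerator L : ↥(maximalRealSubfield L))) := by
    intro v hv
    by_contra h
    exact hv (hfinS.mem_toFinset.2 h)
  -- local symbols at the finite places, as a function
  set h : HeightOneSpectrum (𝓞 ↥(maximalRealSubfield L)) → ℤ := fun v =>
    hilbertSymbol (v.adicCompletion ↥(maximalRealSubfield L))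
      (ideleFiniteComponent (↥(maximalRealSubfield L)) v W : v.adicCompletion ↥(maximalRealSubfield L))
      (algebraMap _ _ (cmQuadraticGenerator L : ↥(maximalRealSubfield L))) with hhdef
  have hκv : ∀ v, finKappaAt L v H' (rationalComponent L γH v) ((UnitaryGroup.cmDatum L 3 H').toLocal v p.adele) = h v := fun v => by
    rw [p.finKappaAt_toLocal_eq_hilbertSymbol hGreg hg hv₀ hv₀0 W hW v, hhdef]
    simp only [val_ideleFiniteComponent, algebraMap_adicCompletion_apply]
  -- `h v = 1` off `S`
  have hθv : ∀ v : HeightOneSpectrum (𝓞 ↥(maximalRealSubfield L)),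
      (algebraMap (↥(maximalRealSubfield L)) (v.adicCompletion ↥(maximalRealSubfield L)) (cmQuadraticGenerator L : ↥(maximalRealSubfield L))) ≠ 0 := fun v => by
    rw [ne_eq, ← map_zero (algebraMap (↥(maximalRealSubfield L)) (v.adicCompletion ↥(maximalRealSubfield L)))]
    exact fun h0 => hθ0 ((algebraMap (↥(maximalRealSubfield L)) (v.adicCompletion ↥(maximalRealSubfield L))).injective h0)
  have h1 : ∀ v ∉ S, h v = 1 := fun v hv => by
    haveI : CharZero (v.adicCompletion ↥(maximalRealSubfield L)) :=
      charZero_of_injective_algebraMap (algebraMap (↥(maximalRealSubfield L)) (v.adicCompletion ↥(maximalRealSubfield L))).injective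
    haveI : NeZero (2 : v.adicCompletion ↥(maximalRealSubfield L)) := ⟨two_ne_zero⟩
    exact (hilbertSymbol_eq_one_iff_mem_quadraticNormSubgroup (hθv v) _).2 (hS v hv)
  have hsupp : Function.mulSupport h ⊆ S := fun v hv => by
    by_contra hvS
    exact hv (h1 v hvS)
  rw [finprod_congr hκv, finprod_eq_prod_of_mulSupport_subset h hsupp, Finset.prod_congr rfl fun w _ => harch w,
    Fintype.prod_equiv ((Equiv.subtypeUnivEquiv fun w : InfinitePlace L => IsTotallyComplex.isComplex w).trans (IsCMField.equivInfinitePlace L))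
      (fun w : {w : InfinitePlace L // IsComplex w} =>
        hilbertSymbol (IsCMField.equivInfinitePlace L w.1).Completion
          ((((W : (AdeleRing (𝓞 ↥(maximalRealSubfield L)) ↥(maximalRealSubfield L))ˣ) : AdeleRing (𝓞 ↥(maximalRealSubfield L)) ↥(maximalRealSubfield L)).1
            (IsCMField.equivInfinitePlace L w.1) : (IsCMField.equivInfinitePlace L w.1).Completion))
          (algebraMap ↥(maximalRealSubfield L) _ (cmQuadraticGenerator L : ↥(maximalRealSubfield L))))
      (fun w' : InfinitePlace ↥(maximalRealSubfield L) =>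
        hilbertSymbol w'.Completion (ideleInfiniteComponent (↥(maximalRealSubfield L)) w' W : w'.Completion)
          (algebraMap ↥(maximalRealSubfield L) _ (cmQuadraticGenerator L : ↥(maximalRealSubfield L))))
      fun w => rfl]
  -- the total product of local symbols is `±1` according to `[W]`
  have hiff := quadraticArtinIndicator_eq_zero_iff_prod_hilbertSymbol_eq_one (not_isSquare_cmQuadraticGenerator L) W S hS
  have hpm : (∏ v ∈ S, h v) * ∏ w' : InfinitePlace ↥(maximalRealSubfield L),
      hilbertSymbol w'.Completion (ideleInfiniteComponent (↥(maximalRealSubfield L)) w' W : w'.Completion)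
        (algebraMap ↥(maximalRealSubfield L) _ (cmQuadraticGenerator L : ↥(maximalRealSubfield L))) = 1 ∨
      (∏ v ∈ S, h v) * ∏ w' : InfinitePlace ↥(maximalRealSubfield L),
      hilbertSymbol w'.Completion (ideleInfiniteComponent (↥(maximalRealSubfield L)) w' W : w'.Completion)
        (algebraMap ↥(maximalRealSubfield L) _ (cmQuadraticGenerator L : ↥(maximalRealSubfield L))) = -1 := by
    have hA : ∀ v ∈ S, h v = 1 ∨ h v = -1 := fun v _ => hilbertSymbol_eq_one_or_eq_neg_one _ _
    have hB : ∀ w' ∈ (Finset.univ : Finset (InfinitePlace ↥(maximalRealSubfield L))),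
        hilbertSymbol w'.Completion (ideleInfiniteComponent (↥(maximalRealSubfield L)) w' W : w'.Completion)
          (algebraMap ↥(maximalRealSubfield L) _ (cmQuadraticGenerator L : ↥(maximalRealSubfield L))) = 1 ∨
        hilbertSymbol w'.Completion (ideleInfiniteComponent (↥(maximalRealSubfield L)) w' W : w'.Completion)
          (algebraMap ↥(maximalRealSubfield L) _ (cmQuadraticGenerator L : ↥(maximalRealSubfield L))) = -1 :=
      fun w' _ => hilbertSymbol_eq_one_or_eq_neg_one _ _
    rcases prod_eq_one_or_eq_neg_one _ _ hA with ha | ha <;> rcases prod_eq_one_or_eq_neg_one _ _ hB with hb | hb <;>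
      rw [ha, hb] <;> norm_num
  rcases (show ∀ z : ZMod 2, z = 0 ∨ z = 1 by decide)
      (quadraticArtinIndicator (↥(maximalRealSubfield L)) (cmQuadraticGenerator L : ↥(maximalRealSubfield L)) W) with h0 | h1'
  · rw [h0, ZMod.val_zero, pow_zero]
    exact hiff.1 h0
  · rw [h1', ZMod.val_one, pow_one]
    rcases hpm with hp1 | hm1
    · exact absurd (hiff.2 hp1) (by rw [h1']; exact one_ne_zero)
    · exact hm1

end KappaProduct

/-! ## §2 The (4.3.3) clause for `Δ‴`, `Δ‴_∞` and Kottwitz's `cartanObs` -/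

section Clause

variable {L : Type} [Field L] [NumberField L] [IsCMField L] {H' : Matrix (Fin 3) (Fin 3) L}
  {γH : (UnitaryGroup.cmDatum L 2 (Matrix.of fun i j : Fin 2 => if i.val + j.val + 1 = 2 then (1 : L) else 0)).Rational ×
    (UnitaryGroup.cmDatum L 1 (Matrix.of fun i j : Fin 1 => if i.val + j.val + 1 = 1 then (1 : L) else 0)).Rational}
  {γ₀ : (UnitaryGroup.cmDatum L 3 H').Rational}


/-- **`adelicFactor` of the explicit collection, unfolded on a matching adèle**: `(∏ᶠ_v Δ‴_v((γ_H)_v, p_v)) · Δ‴_∞(γ_H ⊗ 1, p_∞)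
= [∏ᶠ τ_v D_v κ_v] · [τ_∞ D_∞ ∏_w κ‴_w]` (all supports matching). [cite: Rogawski1990, §4.3 (4.3.2) p. 43; §4.9 p. 55; §14.6 p. 242] -/
theorem MatchingAdele.adelicFactor_finExplicitCollection_eq (μ : HeckeCharacter L)
    (hl : ∀ (v : HeightOneSpectrum (𝓞 ↥(maximalRealSubfield L)))
      (a : (UnitaryGroup.cmDatum L 2 (Matrix.of fun i j : Fin 2 => if i.val + j.val + 1 = 2 then (1 : L) else 0)).Local v ×
      (UnitaryGroup.cmDatum L 1 (Matrix.of fun i j : Fin 1 => if i.val + j.val + 1 = 1 then (1 : L) else 0)).Local v)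
      (b : (UnitaryGroup.cmDatum L 3 H').Local v)
      (x : (UnitaryGroup.cmDatum L 2 (Matrix.of fun i j : Fin 2 => if i.val + j.val + 1 = 2 then (1 : L) else 0)).Local v ×
      (UnitaryGroup.cmDatum L 1 (Matrix.of fun i j : Fin 1 => if i.val + j.val + 1 = 1 then (1 : L) else 0)).Local v),
      finExplicitDelta L v H' (x * a * x⁻¹) μ b = finExplicitDelta L v H' a μ b)
    (hr : ∀ (v : HeightOneSpectrum (𝓞 ↥(maximalRealSubfield L)))
      (a : (UnitaryGroup.cmDatum L 2 (Matrix.of fun i j : Fin 2 => if i.val + j.val + 1 = 2 then (1 : L) else 0)).Local v ×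
      (UnitaryGroup.cmDatum L 1 (Matrix.of fun i j : Fin 1 => if i.val + j.val + 1 = 1 then (1 : L) else 0)).Local v)
      (b y : (UnitaryGroup.cmDatum L 3 H').Local v),
      finExplicitDelta L v H' a μ (y * b * y⁻¹) = finExplicitDelta L v H' a μ b)
    (p : MatchingAdele L H' γH) :
    adelicFactor L H' (finExplicitCollection L H' μ hl hr) (fun a b => archCanonicalDelta L H' a μ b) γH p =
      ((∏ᶠ v : HeightOneSpectrum (𝓞 ↥(maximalRealSubfield L)),
          finTau L v (rationalComponent L γH v) μ * (finWeylRatio L v (rationalComponent L γH v) : ℂ) *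
            ((finKappaAt L v H' (rationalComponent L γH v) ((UnitaryGroup.cmDatum L 3 H').toLocal v p.adele) : ℤ) : ℂ))) *
        (archTau L (rationalArch L γH) μ * (archWeylRatio L (rationalArch L γH) : ℂ) *
          ((∏ w : {w : InfinitePlace L // IsComplex w}, archKappaSignAt L H' (rationalArch L γH) w p.arch : ℤ) : ℂ)) := by
  change (∏ᶠ v : HeightOneSpectrum (𝓞 ↥(maximalRealSubfield L)),
      finExplicitDelta L v H' (rationalComponent L γH v) μ ((UnitaryGroup.cmDatum L 3 H').toLocal v p.adele)) *
    archCanonicalDelta L H' (rationalArch L γH) μ p.arch = _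
  rw [finprod_congr fun v => finExplicitDelta_of_isLocalNormPair L v H' (rationalComponent L γH v) μ (p.isLocalNormPair v),
    archCanonicalDelta_of_isArchNormPair L H' (rationalArch L γH) μ p.isArchNormPair]

/-- **THE LEFT-HAND SIDE OF (4.3.3) ON AN ADELIC MATCHING PAIR**: `(∏ᶠ_v Δ‴_v((γ_H)_v, p_v)) · Δ‴_∞(γ_H ⊗ 1, p_∞) = (−1)^{[W]_{L⁺,θ}}` — the `τ`- and `D`-parts are `1`
(★ N4 `finprod_finTau_mul_archTau_eq_one`, `finprod_finWeylRatio_mul_archWeylRatio_eq_one`: they read only the rational `γ_H`), the `κ`-part is `(−1)^{[W]}`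
(`finprod_finKappaAt_mul_prod_archKappaSignAt_eq_neg_one_pow`, given the archimedean readings `harch`). [cite: Rogawski1990, §4.3 (4.3.3) p. 44; §14.6 p. 242] -/
theorem MatchingAdele.adelicFactor_finExplicitCollection_eq_neg_one_pow (μ : HeckeCharacter L)
    (hl : ∀ (v : HeightOneSpectrum (𝓞 ↥(maximalRealSubfield L)))
      (a : (UnitaryGroup.cmDatum L 2 (Matrix.of fun i j : Fin 2 => if i.val + j.val + 1 = 2 then (1 : L) else 0)).Local v ×
      (UnitaryGroup.cmDatum L 1 (Matrix.of fun i j : Fin 1 => if i.val + j.val + 1 = 1 then (1 : L) else 0)).Local v)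
      (b : (UnitaryGroup.cmDatum L 3 H').Local v)
      (x : (UnitaryGroup.cmDatum L 2 (Matrix.of fun i j : Fin 2 => if i.val + j.val + 1 = 2 then (1 : L) else 0)).Local v ×
      (UnitaryGroup.cmDatum L 1 (Matrix.of fun i j : Fin 1 => if i.val + j.val + 1 = 1 then (1 : L) else 0)).Local v),
      finExplicitDelta L v H' (x * a * x⁻¹) μ b = finExplicitDelta L v H' a μ b)
    (hr : ∀ (v : HeightOneSpectrum (𝓞 ↥(maximalRealSubfield L)))
      (a : (UnitaryGroup.cmDatum L 2 (Matrix.of fun i j : Fin 2 => if i.val + j.val + 1 = 2 then (1 : L) else 0)).Local v ×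
      (UnitaryGroup.cmDatum L 1 (Matrix.of fun i j : Fin 1 => if i.val + j.val + 1 = 1 then (1 : L) else 0)).Local v)
      (b y : (UnitaryGroup.cmDatum L 3 H').Local v),
      finExplicitDelta L v H' a μ (y * b * y⁻¹) = finExplicitDelta L v H' a μ b)
    (p : MatchingAdele L H' γH)
    (hGreg : IsGRegular (cmConjRingHom L) (Matrix.of fun i j : Fin 2 => if i.val + j.val + 1 = 2 then (1 : L) else 0)
        (Matrix.of fun i j : Fin 1 => if i.val + j.val + 1 = 1 then (1 : L) else 0)
        (Matrix.of fun i j : Fin 3 => if i.val + j.val + 1 = 3 then (1 : L) else 0) endoForm_antidiagOne γH)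
    {g : GL (Fin 3) (AdeleRing (𝓞 L) L)}
    (hg : g * (((UnitaryGroup.cmDatum L 3 H').toAdelic γ₀).val : GL (Fin 3) (AdeleRing (𝓞 L) L)) * g⁻¹ = (p.adele.val : GL (Fin 3) (AdeleRing (𝓞 L) L)))
    {v₀ : Fin 3 → L}
    (hv₀ : (((γ₀ : unitaryGroup (cmConjRingHom L) H').val : GL (Fin 3) L) : Matrix (Fin 3) (Fin 3) L) *ᵥ v₀ = ((γH.2.val.val : Matrix (Fin 1) (Fin 1) L) 0 0) • v₀)
    (hv₀0 : v₀ ≠ 0) (W : (AdeleRing (𝓞 ↥(maximalRealSubfield L)) ↥(maximalRealSubfield L))ˣ)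
    (hW : ((AdeleRing.ideleBaseChange (↥(maximalRealSubfield L)) L W : (AdeleRing (𝓞 L) L)ˣ) : AdeleRing (𝓞 L) L) =
      hermForm (adeleConj L) (H'.map (algebraMap L (AdeleRing (𝓞 L) L)))
        ((g : Matrix (Fin 3) (Fin 3) (AdeleRing (𝓞 L) L)) *ᵥ ((algebraMap L (AdeleRing (𝓞 L) L)) ∘ v₀))
        ((g : Matrix (Fin 3) (Fin 3) (AdeleRing (𝓞 L) L)) *ᵥ ((algebraMap L (AdeleRing (𝓞 L) L)) ∘ v₀)))
    (harch : ∀ w : {w : InfinitePlace L // IsComplex w},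
      archKappaSignAt L H' (rationalArch L γH) w p.arch =
        hilbertSymbol (IsCMField.equivInfinitePlace L w.1).Completion
          ((((W : (AdeleRing (𝓞 ↥(maximalRealSubfield L)) ↥(maximalRealSubfield L))ˣ) : AdeleRing (𝓞 ↥(maximalRealSubfield L)) ↥(maximalRealSubfield L)).1
            (IsCMField.equivInfinitePlace L w.1) : (IsCMField.equivInfinitePlace L w.1).Completion))
          (algebraMap ↥(maximalRealSubfield L) _ (cmQuadraticGenerator L : ↥(maximalRealSubfield L)))) :
    adelicFactor L H' (finExplicitCollection L H' μ hl hr) (fun a b => archCanonicalDelta L H' a μ b) γH p =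
      (-1 : ℂ) ^ (quadraticArtinIndicator (↥(maximalRealSubfield L)) (cmQuadraticGenerator L : ↥(maximalRealSubfield L)) W).val := by
  rw [p.adelicFactor_finExplicitCollection_eq μ hl hr]
  -- finiteness of the three supports
  have hτf : (Function.mulSupport fun v : HeightOneSpectrum (𝓞 ↥(maximalRealSubfield L)) => finTau L v (rationalComponent L γH v) μ).Finite := by
    have h1 := finite_mulSupport_finHeckeValue_algebraMap L μ (Units.mk0 _ (gammaTwo_ne_zero L γH))
    have h2 := finite_mulSupport_finHeckeValue_algebraMap L μ (Units.mk0 _ (tauArg_ne_zero L γH hGreg))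
    refine (h1.union h2).subset fun v hv => ?_
    simp only [Function.mem_mulSupport, ne_eq] at hv
    by_contra hv'
    rw [Set.mem_union, not_or, Function.notMem_mulSupport, Function.notMem_mulSupport, Units.val_mk0, Units.val_mk0] at hv'
    refine hv ?_
    rw [finTau_rationalComponent, hv'.1, hv'.2, inv_one, mul_one]
  have hDf : (Function.mulSupport fun v : HeightOneSpectrum (𝓞 ↥(maximalRealSubfield L)) =>
      ((finWeylRatio L v (rationalComponent L γH v) : ℝ) : ℂ)).Finite := by
    refine (eventually_cofinite.1 (eventually_prod_placesOver_norm_coe_eq_one (↥(maximalRealSubfield L)) (E := L)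
      (eval_charpoly_gammaTwo_ne_zero_of_isGRegular L γH hGreg))).subset fun v hv => ?_
    simp only [Function.mem_mulSupport, ne_eq] at hv
    by_contra hv'
    rw [Set.mem_setOf_eq, not_not] at hv'
    refine hv ?_
    rw [finWeylRatio_rationalComponent]
    have h1 : (∏ w : UnitaryGroup.PlacesOver L v, ‖algebraMap L (w.1.adicCompletion L)
        (((γH.1.val.val : Matrix (Fin 2) (Fin 2) L).charpoly).eval ((γH.2.val.val : Matrix (Fin 1) (Fin 1) L) 0 0))‖) = 1 := by
      rw [← hv']
      exact Finset.prod_congr rfl fun w _ => by rw [algebraMap_adicCompletion_apply]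
    rw [h1, Real.sqrt_one, Complex.ofReal_one]
  have hκf : (Function.mulSupport fun v : HeightOneSpectrum (𝓞 ↥(maximalRealSubfield L)) =>
      ((finKappaAt L v H' (rationalComponent L γH v) ((UnitaryGroup.cmDatum L 3 H').toLocal v p.adele) : ℤ) : ℂ)).Finite := by
    refine (eventually_cofinite.1 (p.eventually_finKappaAt_toLocal_eq_one hGreg hg hv₀ hv₀0 W hW)).subset fun v hv => ?_
    simp only [Function.mem_mulSupport, ne_eq] at hv
    by_contra hv'
    rw [Set.mem_setOf_eq, not_not] at hv'
    exact hv (by rw [hv', Int.cast_one])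
  -- the three parts
  have hτ := finprod_finTau_mul_archTau_eq_one L μ γH hGreg
  have hD := finprod_finWeylRatio_mul_archWeylRatio_eq_one L γH hGreg
  have hκ := p.finprod_finKappaAt_mul_prod_archKappaSignAt_eq_neg_one_pow hGreg hg hv₀ hv₀0 W hW harch
  have hDℂ : (∏ᶠ v : HeightOneSpectrum (𝓞 ↥(maximalRealSubfield L)), ((finWeylRatio L v (rationalComponent L γH v) : ℝ) : ℂ)) *
      (archWeylRatio L (rationalArch L γH) : ℂ) = 1 := by
    have hDf' : (Function.mulSupport fun v : HeightOneSpectrum (𝓞 ↥(maximalRealSubfield L)) =>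
        finWeylRatio L v (rationalComponent L γH v)).Finite :=
      hDf.subset fun v hv hv1 => hv (by
        change ((finWeylRatio L v (rationalComponent L γH v) : ℝ) : ℂ) = 1 at hv1
        change finWeylRatio L v (rationalComponent L γH v) = 1
        exact_mod_cast hv1)
    have hmap := map_finprod Complex.ofRealHom hDf'
    simp only [Complex.ofRealHom_eq_coe] at hmap
    rw [← hmap, ← Complex.ofReal_mul, hD, Complex.ofReal_one]
  have hκℂ : (∏ᶠ v : HeightOneSpectrum (𝓞 ↥(maximalRealSubfield L)),
        ((finKappaAt L v H' (rationalComponent L γH v) ((UnitaryGroup.cmDatum L 3 H').toLocal v p.adele) : ℤ) : ℂ)) *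
      ((∏ w : {w : InfinitePlace L // IsComplex w}, archKappaSignAt L H' (rationalArch L γH) w p.arch : ℤ) : ℂ) =
      (-1 : ℂ) ^ (quadraticArtinIndicator (↥(maximalRealSubfield L)) (cmQuadraticGenerator L : ↥(maximalRealSubfield L)) W).val := by
    have hκf' : (Function.mulSupport fun v : HeightOneSpectrum (𝓞 ↥(maximalRealSubfield L)) =>
        finKappaAt L v H' (rationalComponent L γH v) ((UnitaryGroup.cmDatum L 3 H').toLocal v p.adele)).Finite :=
      hκf.subset fun v hv hv1 => hv (by
        change ((finKappaAt L v H' (rationalComponent L γH v) ((UnitaryGroup.cmDatum L 3 H').toLocal v p.adele) : ℤ) : ℂ) = 1 at hv1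
        change finKappaAt L v H' (rationalComponent L γH v) ((UnitaryGroup.cmDatum L 3 H').toLocal v p.adele) = 1
        exact_mod_cast hv1)
    have hmap := map_finprod (Int.castRingHom ℂ) hκf'
    simp only [Int.coe_castRingHom] at hmap
    rw [← hmap, ← Int.cast_mul, hκ, Int.cast_pow, Int.cast_neg, Int.cast_one]
  rw [finprod_mul_distrib ((hτf.union hDf).subset (Function.mulSupport_mul _ _)) hκf, finprod_mul_distrib hτf hDf]
  calc (∏ᶠ v : HeightOneSpectrum (𝓞 ↥(maximalRealSubfield L)), finTau L v (rationalComponent L γH v) μ) *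
          (∏ᶠ v : HeightOneSpectrum (𝓞 ↥(maximalRealSubfield L)), ((finWeylRatio L v (rationalComponent L γH v) : ℝ) : ℂ)) *
          (∏ᶠ v : HeightOneSpectrum (𝓞 ↥(maximalRealSubfield L)),
            ((finKappaAt L v H' (rationalComponent L γH v) ((UnitaryGroup.cmDatum L 3 H').toLocal v p.adele) : ℤ) : ℂ)) *
        (archTau L (rationalArch L γH) μ * (archWeylRatio L (rationalArch L γH) : ℂ) *
          ((∏ w : {w : InfinitePlace L // IsComplex w}, archKappaSignAt L H' (rationalArch L γH) w p.arch : ℤ) : ℂ))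
      = ((∏ᶠ v : HeightOneSpectrum (𝓞 ↥(maximalRealSubfield L)), finTau L v (rationalComponent L γH v) μ) * archTau L (rationalArch L γH) μ) *
        ((∏ᶠ v : HeightOneSpectrum (𝓞 ↥(maximalRealSubfield L)), ((finWeylRatio L v (rationalComponent L γH v) : ℝ) : ℂ)) *
          (archWeylRatio L (rationalArch L γH) : ℂ)) *
        ((∏ᶠ v : HeightOneSpectrum (𝓞 ↥(maximalRealSubfield L)),
            ((finKappaAt L v H' (rationalComponent L γH v) ((UnitaryGroup.cmDatum L 3 H').toLocal v p.adele) : ℤ) : ℂ)) *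
          ((∏ w : {w : InfinitePlace L // IsComplex w}, archKappaSignAt L H' (rationalArch L γH) w p.arch : ℤ) : ℂ)) := by
        ring
    _ = _ := by rw [hτ, hDℂ, hκℂ, one_mul, one_mul]

variable (L H') (μ : HeckeCharacter L)

/-- **THE GLOBAL TRANSFER-FACTOR IDENTITY (4.3.3) FOR ROGAWSKI'S EXPLICIT COLLECTION AND KOTTWITZ'S OBSTRUCTION** — the clause
`GlobalKappaFormula L H′ Δ‴ Δ‴_∞ (cartanObs ∘ toSelf hγ) (e 𝒪H)` of ★ `GlobalTransferWithCartanKappaFormula` (ED. 5, :146–:178) at `Δ‴ := finExplicitCollection`,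
`Δ‴_∞ := archCanonicalDelta`, TOKEN FOR TOKEN: for `H′` anisotropic hermitian with `det H′` a unit, `γ₀` regular, the dictionary `s` with its pins and every
`γ_H → γ₀`, and EVERY matching adèle `p` over `γ_H`: `(∏ᶠ_v Δ‴_v((γ_H)_v, p_v)) · Δ‴_∞(γ_H ⊗ 1, p_∞) = (e 𝒪H)(obs p)`.  Proof: `τ` and `D_{G∕H}` read only the
rational `γ_H` and die by ★ `finprod_finTau_mul_archTau_eq_one` ∕ ★ `finprod_finWeylRatio_mul_archWeylRatio_eq_one` (N4); the `κ`'s are the local symbols of the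
`H′`-value idèle `W` of the transported eigenvector (★ (A1) `finKappaAt_toLocal_eq_hilbertSymbol`, (A2)), whose total product is `(−1)^{[W]}` =
`(−1)^{(obs p)_{s 𝒪H}}` (★ `cartanObsFun_eq_quadraticArtinIndicator_hermForm`) `= (e 𝒪H)(obs p)` by the pin `e(𝒪H)(ε) = (−1)^{ε(s 𝒪H)}`.
[cite: Rogawski1990, §4.3 (4.3.2)–(4.3.3) pp. 43–44; §14.6 p. 242; §5.4 (5.4.5) p. 73] [cite: LanglandsShelstad1987, §6.4 Thm. 6.4.A, Cor. 6.4.B] [cite: Kottwitz1986, §9] -/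
theorem globalKappaFormula_finExplicitCollection
    (hl : ∀ (v : HeightOneSpectrum (𝓞 ↥(maximalRealSubfield L)))
      (a : (UnitaryGroup.cmDatum L 2 (Matrix.of fun i j : Fin 2 => if i.val + j.val + 1 = 2 then (1 : L) else 0)).Local v ×
      (UnitaryGroup.cmDatum L 1 (Matrix.of fun i j : Fin 1 => if i.val + j.val + 1 = 1 then (1 : L) else 0)).Local v)
      (b : (UnitaryGroup.cmDatum L 3 H').Local v)
      (x : (UnitaryGroup.cmDatum L 2 (Matrix.of fun i j : Fin 2 => if i.val + j.val + 1 = 2 then (1 : L) else 0)).Local v ×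
      (UnitaryGroup.cmDatum L 1 (Matrix.of fun i j : Fin 1 => if i.val + j.val + 1 = 1 then (1 : L) else 0)).Local v),
      finExplicitDelta L v H' (x * a * x⁻¹) μ b = finExplicitDelta L v H' a μ b)
    (hr : ∀ (v : HeightOneSpectrum (𝓞 ↥(maximalRealSubfield L)))
      (a : (UnitaryGroup.cmDatum L 2 (Matrix.of fun i j : Fin 2 => if i.val + j.val + 1 = 2 then (1 : L) else 0)).Local v ×
      (UnitaryGroup.cmDatum L 1 (Matrix.of fun i j : Fin 1 => if i.val + j.val + 1 = 1 then (1 : L) else 0)).Local v)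
      (b y : (UnitaryGroup.cmDatum L 3 H').Local v),
      finExplicitDelta L v H' a μ (y * b * y⁻¹) = finExplicitDelta L v H' a μ b) :
    (∀ x : Fin 3 → L, hermForm (cmConjRingHom L) H' x x = 0 → x = 0) →
      ∀ (hH : (H'.map (cmConjRingHom L))ᵀ = H') (hHd : IsUnit H'.det)
        (γ₀ : (UnitaryGroup.cmDatum L 3 H').Rational) (hreg : IsRegularElt (γ₀.val : GL (Fin 3) L))
        [Fintype (cartanIndexCM hH hHd hreg)]
        (s : {𝒪H : StableClassH (cmConjRingHom L) (Matrix.of fun i j : Fin 2 => if i.val + j.val + 1 = 2 then (1 : L) else 0)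
                (Matrix.of fun i j : Fin 1 => if i.val + j.val + 1 = 1 then (1 : L) else 0) //
              𝒪H.TransfersTo H' endoForm_antidiagOne (stableClassOf (cmConjRingHom L) H' γ₀)} → cartanIndexCM hH hHd hreg)
        (e : {𝒪H : StableClassH (cmConjRingHom L) (Matrix.of fun i j : Fin 2 => if i.val + j.val + 1 = 2 then (1 : L) else 0)
                (Matrix.of fun i j : Fin 1 => if i.val + j.val + 1 = 1 then (1 : L) else 0) //
              𝒪H.TransfersTo H' endoForm_antidiagOne (stableClassOf (cmConjRingHom L) H' γ₀)} ≃
            {χ : (⊤ : Subgroup (AddChar ↥(cartanObsSubgroup (cartanIndexCM hH hHd hreg)) ℂ)) // χ ≠ 1}),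
        Function.Injective s →
        (∀ 𝔪 : cartanIndexCM hH hHd hreg, (∃ x, s x = 𝔪) ↔ Module.finrank L (↥(Algebra.adjoin L ({(((γ₀ : unitaryGroup (cmConjRingHom L) H').val : GL (Fin 3) L) : Matrix (Fin 3) (Fin 3) L)} :
                    Set (Matrix (Fin 3) (Fin 3) L))) ⧸ 𝔪.1.asIdeal) = 1) →
        (∀ x, (⟨(((γ₀ : unitaryGroup (cmConjRingHom L) H').val : GL (Fin 3) L) : Matrix (Fin 3) (Fin 3) L), Algebra.self_mem_adjoin_singleton L _⟩ :
                ↥(Algebra.adjoin L ({(((γ₀ : unitaryGroup (cmConjRingHom L) H').val : GL (Fin 3) L) : Matrix (Fin 3) (Fin 3) L)} :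
                    Set (Matrix (Fin 3) (Fin 3) L)))) -
            algebraMap L _ x.1.sndVal ∈ (s x).1.asIdeal) →
        (∀ x (ε : ↥(cartanObsSubgroup (cartanIndexCM hH hHd hreg))),
            (((e x : (⊤ : Subgroup (AddChar ↥(cartanObsSubgroup (cartanIndexCM hH hHd hreg)) ℂ))) : AddChar ↥(cartanObsSubgroup (cartanIndexCM hH hHd hreg)) ℂ)) ε =
              (-1 : ℂ) ^ ((ε : cartanIndexCM hH hHd hreg → ZMod 2) (s x)).val) →
        ∀ (γH : (UnitaryGroup.cmDatum L 2 (Matrix.of fun i j : Fin 2 => if i.val + j.val + 1 = 2 then (1 : L) else 0)).Rational ×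
            (UnitaryGroup.cmDatum L 1 (Matrix.of fun i j : Fin 1 => if i.val + j.val + 1 = 1 then (1 : L) else 0)).Rational)
          (hγ : IsNormPair L H' γH γ₀),
          GlobalKappaFormula L H' (finExplicitCollection L H' μ hl hr) (fun a b => archCanonicalDelta L H' a μ b)
            (fun p : MatchingAdele L H' γH => MatchingAdeleG₂.cartanObs hH hHd hreg (MatchingAdele.toSelf hγ p))
            (((e ⟨stableClassHOf (cmConjRingHom L) _ _ γH, hγ⟩).1 :
                (⊤ : Subgroup (AddChar ↥(cartanObsSubgroup (cartanIndexCM hH hHd hreg)) ℂ))) : AddChar ↥(cartanObsSubgroup (cartanIndexCM hH hHd hreg)) ℂ) := by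
  intro hanis hH hHd γ₀ hreg _ s e hsinj hsdeg hsdict hepins γH hγ p
  -- the degree-one factor `𝔪 = s x`, `x = (𝒪′_st(γ_H), hγ)`, with `γ₀ − u ∈ 𝔪`, `u = (γ_H.2)₀₀ = sndVal 𝒪′_st(γ_H)`
  have hu : (⟨(((γ₀ : unitaryGroup (cmConjRingHom L) H').val : GL (Fin 3) L) : Matrix (Fin 3) (Fin 3) L), Algebra.self_mem_adjoin_singleton L _⟩ : ↥(cartanSubalgebra γ₀)) -
      algebraMap L ↥(cartanSubalgebra γ₀) ((γH.2.val.val : Matrix (Fin 1) (Fin 1) L) 0 0) ∈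
        (s ⟨stableClassHOf (cmConjRingHom L) _ _ γH, hγ⟩).1.asIdeal := hsdict ⟨stableClassHOf (cmConjRingHom L) _ _ γH, hγ⟩
  have hGreg : IsGRegular (cmConjRingHom L) (Matrix.of fun i j : Fin 2 => if i.val + j.val + 1 = 2 then (1 : L) else 0)
      (Matrix.of fun i j : Fin 1 => if i.val + j.val + 1 = 1 then (1 : L) else 0)
      (Matrix.of fun i j : Fin 3 => if i.val + j.val + 1 = 3 then (1 : L) else 0) endoForm_antidiagOne γH :=
    isRegularElt_of_isConj (isNormPair_iff_isConj.mp hγ).symm hreg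
  obtain ⟨v₀, hv₀0, hv₀⟩ := exists_mulVec_eq_smul_of_matrixGen_sub_algebraMap_mem _ hu
  -- the chosen adelic conjugator of `q = toSelf hγ p` conjugates `γ₀ ⊗ 1` to `p.adele` (same adèle, ★ `MatchingAdele.adele_toSelf`)
  have hq := (MatchingAdele.toSelf hγ p).adelicConjugator_conj hreg
  have hg : (MatchingAdele.toSelf hγ p).adelicConjugator hreg * (((UnitaryGroup.cmDatum L 3 H').toAdelic γ₀).val : GL (Fin 3) (AdeleRing (𝓞 L) L)) *
      ((MatchingAdele.toSelf hγ p).adelicConjugator hreg)⁻¹ = (p.adele.val : GL (Fin 3) (AdeleRing (𝓞 L) L)) := by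
    rw [← MatchingAdele.adele_toSelf hγ p]
    exact hq
  obtain ⟨W, hW⟩ := (MatchingAdele.toSelf hγ p).exists_ideleBaseChange_eq_hermForm hH hHd hreg _ hu hv₀ hv₀0 hq
  -- RHS: the pinned character at `obs p` is `(−1)^{(obs p)_𝔪} = (−1)^{[W]}`
  rw [hepins, MatchingAdeleG₂.coe_cartanObs,
    (MatchingAdele.toSelf hγ p).neg_one_pow_cartanObsFun_eq_neg_one_pow_quadraticArtinIndicator hH hHd hreg _ hu hv₀ hv₀0 hq W hW]
  -- LHS
  exact p.adelicFactor_finExplicitCollection_eq_neg_one_pow μ hl hr hGreg hg hv₀ hv₀0 W hW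
    (fun w => p.archKappaSignAt_arch_eq_hilbertSymbol hH hanis hGreg hg hv₀ hv₀0 W hW w)

end Clause

end Literature.NumberTheory.Rogawski1990

end
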